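import Literature.RepresentationTheory.HeisenbergGroup.DoubledDeltaDoublingIdentity
import Literature.RepresentationTheory.HeisenbergGroup.SchrodingerConjugateGram
import HarnessLib

/-!
# Kudla's `j̃` on MVW pairs: the box homomorphism `S̃p_ψ(W_{T₁}) × S̃p_ψ(W_{T₂}) →* S̃p_ψ(W_{T₁ ⊕ T₂})`, and the
# conjugation homomorphism `S̃p_ψ(W_J) →* S̃p_ψ(W_{−J})`

Topic `RepresentationTheory/HeisenbergGroup`; namespace `Literature.RepresentationTheory.HeisenbergGroup`.  KERNEL ONLY:
two definitions with bodies (homomorphisms) and their unfolding theorems; no named fact, no `sorry`.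

[MoeglinVignerasWaldspurger1987, Chap. 2 II.1 Rem. (6)] / [Kudla1996, Chap. I §1]: «il existe un homomorphisme
`j : S̃p(W₁) × S̃p(W₂) ⟶ S̃p(W)` … commutant avec les projections sur les groupes symplectiques … `ω_ψ ∘ j ≃ ω_{ψ,1} ⊠ ω_{ψ,2}`»
— Kudla's `j̃((g₁, A(g₁)), (g₂, A(g₂))) = (j(g₁, g₂), A(g₁) ⊗ A(g₂))`.  The tree holds this at the level of single pairs
(`MetaplecticSumStrippingRight.implements_of_boxSB`: `M₁ ⊠ M₂` implements `spInl g₁ · spInr g₂`; the operator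
`boxEquivSB e M₁ M₂` of `DoubledDeltaDoublingIdentity`) and records the abstract statement as the typed skeleton
`MetaplecticDirectSum.MetaplecticSumDatum`.  This file packages the HOMOMORPHISM:

* `MpPsi.boxHom … : MpPsi ρ_{T₁} × MpPsi ρ_{T₂} →* MpPsi ρ_T` for `T = reindex e e (T₁ ⊕ T₂)` on the Schrödinger models
  `ρ_• = schrodingerSB (toLinearMap₂' K •) ψ` of `𝒮(K^{ι₁})`, `𝒮(K^{ι₂})`, `𝒮(K^ι) = 𝒮(K^{ι₁}) ⊗ 𝒮(K^{ι₂})`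
  (`(p₁, p₂) ↦ (spInl π(p₁) · spInr π(p₂), op(p₁) ⊠ op(p₂))`), with `proj_boxHom`, `toRep_boxHom_boxSB`
  (`ω(j̃(p₁,p₂))(f₁ ⊠ f₂) = ω(p₁) f₁ ⊠ ω(p₂) f₂`);
* `MpPsi.conjHom … : MpPsi ρ_J →* MpPsi ρ_{−J}`, `(g, M) ↦ (g, conj ∘ M ∘ conj)` (same symplectic element read in
  `Sp(W_{−J}) = Sp(W_J)`; `SchrodingerConjugateGram.conjOp_mem_MpPsi_gram`), with `proj_conjHom`, `toRep_conjHom`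
  (`ω_{−J}(conjHom p) f = conj (ω_J(p) (conj f))`) — «the Weil representation of `𝕎⁻` realised on `S̄`»
  [MoeglinVignerasWaldspurger1987, Chap. 2 II.1 (A); Chap. 4 II.1], [HarrisKudlaSweet1996, §1 (1.4)].

Use (cell `hodgecm-mathlib`, row IV-4(c1) `rankOne_theta_lines_disjoint`, KEY `b4-rank-one-theta-lines-disjoint` P1/P5): the
DIAGONAL DOUBLING `u ↦ j̃(s₁ u, conjHom (s₂ u))` of two sections of `U(V)(F_v)` over two embeddings `ι_{δ₁}, ι_{δ₂}` into
`Sp(𝕎_T)`, a homomorphism `U(V)(F_v) →* S̃p_ψ(𝕎_{T ⊕ −T})` acting on `𝒮(F_v^{n ⊕ n})` by `ω_{s₁}(u) ⊠ ω̄_{s₂}(u)`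
(`GelbartRogawski1991/LocalUnitaryDiagonalDoubling.lean`).  Nothing about theta lifts is asserted here; HC_CM is proved
only modulo the 7 printed citations until rung 0 of the ladder closes.

## References
* [MoeglinVignerasWaldspurger1987] C. Mœglin, M.-F. Vignéras, J.-L. Waldspurger, LNM 1291 (1987), Chap. 2 II.1 (A),
  Rem. (6); Chap. 4 II.1.
* [Kudla1996] S. Kudla, *Notes on the local theta correspondence* (1996), Chap. I §1 (`j̃`).
* [HarrisKudlaSweet1996] M. Harris, S. Kudla, W. Sweet, J. AMS 9 (1996), §1 (1.4).
-/

set_option autoImplicit false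

noncomputable section

namespace Literature.RepresentationTheory.HeisenbergGroup

open Literature.NumberTheory.Automorphic

/-! ## §0 Extensionality in `S̃p_ψ` -/

section Ext

variable {R : Type*} [CommRing R] [Invertible (2 : R)] {V : Type*} [AddCommGroup V] [Module R V]
  {B : V →ₗ[R] V →ₗ[R] R} {k : Type*} [CommRing k] {S : Type*} [AddCommGroup S] [Module k S]
  {ρ : Representation k (Heisenberg B) S}

/-- two elements of `S̃p_ψ(W)` with the same symplectic and operator components are equal.
[cite: MoeglinVignerasWaldspurger1987, Chap. 2 II.1 (A)] -/
theorem MpPsi.ext_of_proj_of_toOp {x y : MpPsi ρ} (h₁ : MpPsi.proj ρ x = MpPsi.proj ρ y)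
    (h₂ : MpPsi.toOp ρ x = MpPsi.toOp ρ y) : x = y :=
  Subtype.ext (Prod.ext h₁ h₂)

end Ext

/-! ## §1 The box homomorphism `j̃` -/

section Box

variable {K : Type*} [Field K] [ValuativeRel K] [TopologicalSpace K] [IsNonarchimedeanLocalField K]
  [Invertible (2 : K)] {ι₁ ι₂ ι : Type*} [Fintype ι₁] [Fintype ι₂] [Fintype ι]
  [DecidableEq ι₁] [DecidableEq ι₂] [DecidableEq ι]
  (e : ι₁ ⊕ ι₂ ≃ ι) (T₁ : Matrix ι₁ ι₁ K) (T₂ : Matrix ι₂ ι₂ K) {T : Matrix ι ι K}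
  (hT : T = Matrix.reindex e e (Matrix.fromBlocks T₁ 0 0 T₂))
  {ψ : AddChar K Circle} (hl : IsLocallyConstant (⇑ψ : K → Circle))
  (hb₁ : ∀ y : ι₁ → K, Continuous fun u : ι₁ → K => Matrix.toLinearMap₂' K T₁ u y)
  (hb₂ : ∀ y : ι₂ → K, Continuous fun u : ι₂ → K => Matrix.toLinearMap₂' K T₂ u y)
  (hb : ∀ y : ι → K, Continuous fun u : ι → K => Matrix.toLinearMap₂' K T u y)

omit [Invertible (2 : K)] [DecidableEq ι₁] [DecidableEq ι₂] [DecidableEq ι] in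
/-- Two linear automorphisms of `𝒮(K^ι)` that agree on all products `f₁ ⊠ f₂` are equal. [cite: MoeglinVignerasWaldspurger1987, Chap. 2 II.1 Rem. (6)] -/
theorem linearEquiv_ext_boxSB {A B : SchwartzBruhat (ι → K) ≃ₗ[ℂ] SchwartzBruhat (ι → K)}
    (h : ∀ (f₁ : SchwartzBruhat (ι₁ → K)) (f₂ : SchwartzBruhat (ι₂ → K)), A (boxSB K e f₁ f₂) = B (boxSB K e f₁ f₂)) :
    A = B :=
  LinearEquiv.toLinearMap_injective (linearMap_ext_boxSB K e (fun f₁ f₂ => h f₁ f₂))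

omit [Invertible (2 : K)] [DecidableEq ι₁] [DecidableEq ι₂] [DecidableEq ι] in
/-- `boxEquivSB` is multiplicative: `(M₁ M₁′) ⊠ (M₂ M₂′) = (M₁ ⊠ M₂)(M₁′ ⊠ M₂′)`. [cite: MoeglinVignerasWaldspurger1987, Chap. 2 II.1 Rem. (6)] -/
theorem boxEquivSB_mul (M₁ M₁' : SchwartzBruhat (ι₁ → K) ≃ₗ[ℂ] SchwartzBruhat (ι₁ → K))
    (M₂ M₂' : SchwartzBruhat (ι₂ → K) ≃ₗ[ℂ] SchwartzBruhat (ι₂ → K)) :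
    boxEquivSB K e (M₁ * M₁') (M₂ * M₂') = boxEquivSB K e M₁ M₂ * boxEquivSB K e M₁' M₂' :=
  linearEquiv_ext_boxSB e fun f₁ f₂ => by
    rw [boxEquivSB_boxSB, LinearEquiv.mul_apply, LinearEquiv.mul_apply, LinearEquiv.mul_apply, boxEquivSB_boxSB,
      boxEquivSB_boxSB]

omit [Invertible (2 : K)] [DecidableEq ι₁] [DecidableEq ι₂] [DecidableEq ι] in
/-- `1 ⊠ 1 = 1`. [cite: MoeglinVignerasWaldspurger1987, Chap. 2 II.1 Rem. (6)] -/
theorem boxEquivSB_one : boxEquivSB K e (1 : SchwartzBruhat (ι₁ → K) ≃ₗ[ℂ] SchwartzBruhat (ι₁ → K))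
    (1 : SchwartzBruhat (ι₂ → K) ≃ₗ[ℂ] SchwartzBruhat (ι₂ → K)) = 1 :=
  linearEquiv_ext_boxSB e fun f₁ f₂ => by
    rw [boxEquivSB_boxSB]
    rfl

/-- **The MVW pair `j̃(p₁, p₂) = (π p₁ ⊕ π p₂, op p₁ ⊠ op p₂) ∈ S̃p_ψ(W_T)`** (`M₁ ⊠ M₂` implements `spInl g₁ · spInr g₂`,
`implements_of_boxSB`). [cite: MoeglinVignerasWaldspurger1987, Chap. 2 II.1 Rem. (6)] [cite: Kudla1996, Chap. I §1] -/
def MpPsi.boxPair (p₁ : MpPsi (schrodingerSB (Matrix.toLinearMap₂' K T₁) ψ hl hb₁))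
    (p₂ : MpPsi (schrodingerSB (Matrix.toLinearMap₂' K T₂) ψ hl hb₂)) :
    MpPsi (schrodingerSB (Matrix.toLinearMap₂' K T) ψ hl hb) :=
  ⟨(spInl e T₁ T₂ hT (MpPsi.proj _ p₁) * spInr e T₁ T₂ hT (MpPsi.proj _ p₂),
      boxEquivSB K e (MpPsi.toOp _ p₁) (MpPsi.toOp _ p₂)),
    (mem_MpPsi _ _).2 (implements_of_boxSB e T₁ T₂ hT hl hb₁ hb₂ hb (MpPsi.proj _ p₁) (MpPsi.proj _ p₂)
      (M₁ := MpPsi.toOp _ p₁) (M₂ := MpPsi.toOp _ p₂) (MpPsi.toRep_implements _ p₁) (MpPsi.toRep_implements _ p₂)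
      (fun f₁ f₂ => boxEquivSB_boxSB K e _ _ f₁ f₂))⟩

/-- components of `j̃(p₁, p₂)`. [cite: MoeglinVignerasWaldspurger1987, Chap. 2 II.1 Rem. (6)] -/
theorem MpPsi.coe_boxPair (p₁ : MpPsi (schrodingerSB (Matrix.toLinearMap₂' K T₁) ψ hl hb₁))
    (p₂ : MpPsi (schrodingerSB (Matrix.toLinearMap₂' K T₂) ψ hl hb₂)) :
    ((MpPsi.boxPair e T₁ T₂ hT hl hb₁ hb₂ hb p₁ p₂ : MpPsi (schrodingerSB (Matrix.toLinearMap₂' K T) ψ hl hb)) :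
        symplecticGroup (polar (Matrix.toLinearMap₂' K T)) × (SchwartzBruhat (ι → K) ≃ₗ[ℂ] SchwartzBruhat (ι → K))) =
      (spInl e T₁ T₂ hT (MpPsi.proj _ p₁) * spInr e T₁ T₂ hT (MpPsi.proj _ p₂),
        boxEquivSB K e (MpPsi.toOp _ p₁) (MpPsi.toOp _ p₂)) :=
  rfl

/-- symplectic component of `j̃(p₁, p₂)`. [cite: MoeglinVignerasWaldspurger1987, Chap. 2 II.1 Rem. (6)] -/
theorem MpPsi.proj_boxPair (p₁ : MpPsi (schrodingerSB (Matrix.toLinearMap₂' K T₁) ψ hl hb₁))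
    (p₂ : MpPsi (schrodingerSB (Matrix.toLinearMap₂' K T₂) ψ hl hb₂)) :
    MpPsi.proj _ (MpPsi.boxPair e T₁ T₂ hT hl hb₁ hb₂ hb p₁ p₂) =
      spInl e T₁ T₂ hT (MpPsi.proj _ p₁) * spInr e T₁ T₂ hT (MpPsi.proj _ p₂) :=
  rfl

/-- operator component of `j̃(p₁, p₂)`. [cite: MoeglinVignerasWaldspurger1987, Chap. 2 II.1 Rem. (6)] -/
theorem MpPsi.toOp_boxPair (p₁ : MpPsi (schrodingerSB (Matrix.toLinearMap₂' K T₁) ψ hl hb₁))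
    (p₂ : MpPsi (schrodingerSB (Matrix.toLinearMap₂' K T₂) ψ hl hb₂)) :
    MpPsi.toOp _ (MpPsi.boxPair e T₁ T₂ hT hl hb₁ hb₂ hb p₁ p₂) = boxEquivSB K e (MpPsi.toOp _ p₁) (MpPsi.toOp _ p₂) :=
  rfl

/-- `j̃` is multiplicative (the two symplectic blocks commute, `⊠` is multiplicative).
[cite: MoeglinVignerasWaldspurger1987, Chap. 2 II.1 Rem. (6)] -/
theorem MpPsi.boxPair_mul (p₁ q₁ : MpPsi (schrodingerSB (Matrix.toLinearMap₂' K T₁) ψ hl hb₁))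
    (p₂ q₂ : MpPsi (schrodingerSB (Matrix.toLinearMap₂' K T₂) ψ hl hb₂)) :
    MpPsi.boxPair e T₁ T₂ hT hl hb₁ hb₂ hb (p₁ * q₁) (p₂ * q₂) =
      MpPsi.boxPair e T₁ T₂ hT hl hb₁ hb₂ hb p₁ p₂ * MpPsi.boxPair e T₁ T₂ hT hl hb₁ hb₂ hb q₁ q₂ := by
  refine MpPsi.ext_of_proj_of_toOp ?_ ?_
  · simp only [map_mul, MpPsi.proj_boxPair]
    exact Commute.mul_mul_mul_comm (spInl_mul_spInr_comm e T₁ T₂ hT (MpPsi.proj _ q₁) (MpPsi.proj _ p₂)) _ _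
  · simp only [map_mul, MpPsi.toOp_boxPair, boxEquivSB_mul]

/-- **Kudla's `j̃` on MVW pairs** (the box homomorphism): `((g₁, M₁), (g₂, M₂)) ↦ (g₁ ⊕ g₂, M₁ ⊠ M₂)`, a homomorphism
`S̃p_ψ(W_{T₁}) × S̃p_ψ(W_{T₂}) →* S̃p_ψ(W_T)` for `T = T₁ ⊕ T₂` read through `e`.
[cite: MoeglinVignerasWaldspurger1987, Chap. 2 II.1 Rem. (6)] [cite: Kudla1996, Chap. I §1] -/
def MpPsi.boxHom :
    MpPsi (schrodingerSB (Matrix.toLinearMap₂' K T₁) ψ hl hb₁) × MpPsi (schrodingerSB (Matrix.toLinearMap₂' K T₂) ψ hl hb₂) →*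
      MpPsi (schrodingerSB (Matrix.toLinearMap₂' K T) ψ hl hb) :=
  MonoidHom.mk' (fun p => MpPsi.boxPair e T₁ T₂ hT hl hb₁ hb₂ hb p.1 p.2)
    (fun p q => MpPsi.boxPair_mul e T₁ T₂ hT hl hb₁ hb₂ hb p.1 q.1 p.2 q.2)

/-- `j̃ (p₁, p₂) = boxPair p₁ p₂`. [cite: MoeglinVignerasWaldspurger1987, Chap. 2 II.1 Rem. (6)] -/
theorem MpPsi.boxHom_apply (p₁ : MpPsi (schrodingerSB (Matrix.toLinearMap₂' K T₁) ψ hl hb₁))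
    (p₂ : MpPsi (schrodingerSB (Matrix.toLinearMap₂' K T₂) ψ hl hb₂)) :
    MpPsi.boxHom e T₁ T₂ hT hl hb₁ hb₂ hb (p₁, p₂) = MpPsi.boxPair e T₁ T₂ hT hl hb₁ hb₂ hb p₁ p₂ :=
  rfl

/-- The symplectic component of `j̃(p₁, p₂)` is `spInl π(p₁) · spInr π(p₂)`. [cite: MoeglinVignerasWaldspurger1987, Chap. 2 II.1 Rem. (6)] -/
theorem MpPsi.proj_boxHom (p₁ : MpPsi (schrodingerSB (Matrix.toLinearMap₂' K T₁) ψ hl hb₁))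
    (p₂ : MpPsi (schrodingerSB (Matrix.toLinearMap₂' K T₂) ψ hl hb₂)) :
    MpPsi.proj _ (MpPsi.boxHom e T₁ T₂ hT hl hb₁ hb₂ hb (p₁, p₂)) =
      spInl e T₁ T₂ hT (MpPsi.proj _ p₁) * spInr e T₁ T₂ hT (MpPsi.proj _ p₂) :=
  rfl

/-- **`ω(j̃(p₁, p₂))(f₁ ⊠ f₂) = ω(p₁) f₁ ⊠ ω(p₂) f₂`** (`ω_ψ ∘ j̃ ≃ ω_{ψ,1} ⊠ ω_{ψ,2}` on pure tensors).
[cite: MoeglinVignerasWaldspurger1987, Chap. 2 II.1 Rem. (6)] [cite: Kudla1996, Chap. I §1] -/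
theorem MpPsi.toRep_boxHom_boxSB (p₁ : MpPsi (schrodingerSB (Matrix.toLinearMap₂' K T₁) ψ hl hb₁))
    (p₂ : MpPsi (schrodingerSB (Matrix.toLinearMap₂' K T₂) ψ hl hb₂))
    (f₁ : SchwartzBruhat (ι₁ → K)) (f₂ : SchwartzBruhat (ι₂ → K)) :
    MpPsi.toRep _ (MpPsi.boxHom e T₁ T₂ hT hl hb₁ hb₂ hb (p₁, p₂)) (boxSB K e f₁ f₂) =
      boxSB K e (MpPsi.toRep _ p₁ f₁) (MpPsi.toRep _ p₂ f₂) := by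
  rw [MpPsi.toRep_apply, MpPsi.toRep_apply, MpPsi.toRep_apply, MpPsi.boxHom_apply, MpPsi.coe_boxPair]
  exact boxEquivSB_boxSB K e _ _ f₁ f₂

end Box

/-! ## §2 The conjugation homomorphism `S̃p_ψ(W_J) →* S̃p_ψ(W_{−J})` -/

section Conj

variable {R : Type*} [CommRing R] [Invertible (2 : R)] {ι : Type*} [Fintype ι] [DecidableEq ι]
  [TopologicalSpace R] [IsTopologicalAddGroup R] {ψ : AddChar R Circle} (hl : IsLocallyConstant (⇑ψ : R → Circle))
  (J : Matrix ι ι R)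
  (hb : ∀ y : ι → R, Continuous fun u : ι → R => Matrix.toLinearMap₂' R J u y)
  (hb' : ∀ y : ι → R, Continuous fun u : ι → R => Matrix.toLinearMap₂' R (-J) u y)

omit [CommRing R] [Invertible (2 : R)] [Fintype ι] [DecidableEq ι] [IsTopologicalAddGroup R] in
/-- `conjOp` is multiplicative. [cite: MoeglinVignerasWaldspurger1987, Chap. 2 II.1 (A)] -/
theorem conjOp_mul (M N : SchwartzBruhat (ι → R) ≃ₗ[ℂ] SchwartzBruhat (ι → R)) :
    conjOp (M * N) = conjOp M * conjOp N :=
  LinearEquiv.ext fun f => by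
    rw [conjOp_apply, LinearEquiv.mul_apply, LinearEquiv.mul_apply, conjOp_apply, conjOp_apply, conjSB_conjSB]

omit [CommRing R] [Invertible (2 : R)] [Fintype ι] [DecidableEq ι] [IsTopologicalAddGroup R] in
/-- `conjOp 1 = 1`. [cite: MoeglinVignerasWaldspurger1987, Chap. 2 II.1 (A)] -/
theorem conjOp_one : conjOp (1 : SchwartzBruhat (ι → R) ≃ₗ[ℂ] SchwartzBruhat (ι → R)) = 1 :=
  LinearEquiv.ext fun f => by
    rw [conjOp_apply]
    change conjSB (conjSB f) = f
    exact conjSB_conjSB f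

/-- **The MVW pair `(g, conj ∘ M ∘ conj) ∈ S̃p_ψ(W_{−J})`** of `(g, M) ∈ S̃p_ψ(W_J)` (`conjOp_mem_MpPsi_gram`).
[cite: MoeglinVignerasWaldspurger1987, Chap. 2 II.1 (A); Chap. 4 II.1] -/
def MpPsi.conjPair (p : MpPsi (schrodingerSB (Matrix.toLinearMap₂' R J) ψ hl hb)) :
    MpPsi (schrodingerSB (Matrix.toLinearMap₂' R (-J)) ψ hl hb') :=
  ⟨(⟨((MpPsi.proj _ p : symplecticGroup (polar (Matrix.toLinearMap₂' R J))) : ((ι → R) × (ι → R)) ≃ₗ[R] ((ι → R) × (ι → R))),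
      (mem_symplecticGroup_gram_neg_iff J _).2 (MpPsi.proj _ p).2⟩, conjOp (MpPsi.toOp _ p)),
    conjOp_mem_MpPsi_gram hl hb hb' _ (by rw [MpPsi.proj_apply, MpPsi.toOp_apply, Prod.mk.eta]; exact p.2)⟩

/-- components of `conjPair p`. [cite: MoeglinVignerasWaldspurger1987, Chap. 2 II.1 (A)] -/
theorem MpPsi.coe_conjPair (p : MpPsi (schrodingerSB (Matrix.toLinearMap₂' R J) ψ hl hb)) :
    ((MpPsi.conjPair hl J hb hb' p : MpPsi (schrodingerSB (Matrix.toLinearMap₂' R (-J)) ψ hl hb')) :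
        symplecticGroup (polar (Matrix.toLinearMap₂' R (-J))) × (SchwartzBruhat (ι → R) ≃ₗ[ℂ] SchwartzBruhat (ι → R))) =
      (⟨((MpPsi.proj _ p : symplecticGroup (polar (Matrix.toLinearMap₂' R J))) : ((ι → R) × (ι → R)) ≃ₗ[R] ((ι → R) × (ι → R))),
        (mem_symplecticGroup_gram_neg_iff J _).2 (MpPsi.proj _ p).2⟩, conjOp (MpPsi.toOp _ p)) :=
  rfl

/-- `conjPair` is multiplicative. [cite: MoeglinVignerasWaldspurger1987, Chap. 2 II.1 (A)] -/
theorem MpPsi.conjPair_mul (p q : MpPsi (schrodingerSB (Matrix.toLinearMap₂' R J) ψ hl hb)) :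
    MpPsi.conjPair hl J hb hb' (p * q) = MpPsi.conjPair hl J hb hb' p * MpPsi.conjPair hl J hb hb' q := by
  refine Subtype.ext (Prod.ext (Subtype.ext ?_) ?_)
  · simp only [Subgroup.coe_mul, Prod.fst_mul, MpPsi.coe_conjPair, map_mul]
  · simp only [Subgroup.coe_mul, Prod.snd_mul, MpPsi.coe_conjPair, map_mul, conjOp_mul]

/-- **The conjugation homomorphism** `S̃p_ψ(W_J) →* S̃p_ψ(W_{−J})`, `(g, M) ↦ (g, conj ∘ M ∘ conj)`: the same symplectic
element read in `Sp(W_{−J}) = Sp(W_J)` (`mem_symplecticGroup_gram_neg_iff`) with the conjugate operator — «the Weil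
representation of `𝕎⁻` on `S̄`». [cite: MoeglinVignerasWaldspurger1987, Chap. 2 II.1 (A); Chap. 4 II.1]
[cite: HarrisKudlaSweet1996, §1 (1.4)] -/
def MpPsi.conjHom :
    MpPsi (schrodingerSB (Matrix.toLinearMap₂' R J) ψ hl hb) →* MpPsi (schrodingerSB (Matrix.toLinearMap₂' R (-J)) ψ hl hb') :=
  MonoidHom.mk' (MpPsi.conjPair hl J hb hb') (MpPsi.conjPair_mul hl J hb hb')

/-- `conjHom p = conjPair p`. [cite: MoeglinVignerasWaldspurger1987, Chap. 2 II.1 (A)] -/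
theorem MpPsi.conjHom_apply (p : MpPsi (schrodingerSB (Matrix.toLinearMap₂' R J) ψ hl hb)) :
    MpPsi.conjHom hl J hb hb' p = MpPsi.conjPair hl J hb hb' p :=
  rfl

/-- The symplectic component of `conjHom p` is that of `p` (as a linear automorphism of `R^ι × R^ι`).
[cite: MoeglinVignerasWaldspurger1987, Chap. 2 II.1 (A)] -/
theorem MpPsi.coe_proj_conjHom (p : MpPsi (schrodingerSB (Matrix.toLinearMap₂' R J) ψ hl hb)) :
    ((MpPsi.proj _ (MpPsi.conjHom hl J hb hb' p) : symplecticGroup (polar (Matrix.toLinearMap₂' R (-J)))) :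
        ((ι → R) × (ι → R)) ≃ₗ[R] ((ι → R) × (ι → R))) =
      (MpPsi.proj _ p : symplecticGroup (polar (Matrix.toLinearMap₂' R J))) :=
  rfl

/-- **`ω_{−J}(conjHom p) f = conj (ω_J(p) (conj f))`.** [cite: MoeglinVignerasWaldspurger1987, Chap. 2 II.1 (A); Chap. 4 II.1] -/
theorem MpPsi.toRep_conjHom (p : MpPsi (schrodingerSB (Matrix.toLinearMap₂' R J) ψ hl hb)) (f : SchwartzBruhat (ι → R)) :
    MpPsi.toRep _ (MpPsi.conjHom hl J hb hb' p) f = conjSB (MpPsi.toRep _ p (conjSB f)) := by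
  rw [MpPsi.toRep_apply, MpPsi.toRep_apply, MpPsi.conjHom_apply, MpPsi.coe_conjPair, ← MpPsi.toOp_apply]
  exact conjOp_apply _ f

end Conj

end Literature.RepresentationTheory.HeisenbergGroup

end
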